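import Mathlib.Data.List.GetD
import Mathlib.Tactic.IntervalCases
import Literature.Computability.FineGrained.EditDistanceOVGadgets
import Literature.Computability.FineGrained.BKGadgetStructure
import Literature.Computability.FineGrained.LCSOVBits
import HarnessLib

/-!
# From Orthogonal Vectors to binary edit distance: the strings of the reduction, bit by bit

Positional (random-access) description of the strings `BKReduction.ovX I`, `BKReduction.ovY I` of
`Literature.Computability.FineGrained.EditDistanceOVGadgets` (Bringmann–Künnemann, FOCS 2015,
§3.1 with §5.2: the alignment gadget `G(z) = (1^{γ₁} 0^{γ₁})² z (0^{γ₁} 1^{γ₁})²` of Lemma 5.3,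
blocks separated by `0^{γ₂}`, the `y`-string padded by `0^{nγ₃}`), in the form consumed by the
word-RAM program of the reduction (`Literature.Computability.FineGrained.EditDistOVProgram`), which
writes the two strings one bit per loop iteration from closed-form position arithmetic:

* `BKGadget.Params.blockBit P ℓ z r`: bit `r` of a period
  `G(z) 0^{γ₂} = 1^{γ₁} 0^{γ₁} 1^{γ₁} 0^{γ₁} z 0^{γ₁} 1^{γ₁} 0^{γ₁} 1^{γ₁} 0^{γ₂}` for a block `z` of
  length `ℓ` (ten ranges), `BKGadget.Params.perOf P ℓ = 8γ₁ + ℓ + γ₂` its length, and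
  **`getD_gadgetX`**: bit `p` of `G(z₀) 0^{γ₂} ⋯ G(z_{k-1})` (blocks of a common length `ℓ > 0`) is
  `blockBit P ℓ z_{p / per} (p % per)`; `getD_gadgetY`: bit `p` of `0^N core 0^N`, `N = n γ₃`;
* the numerals of level `1` (`BKReduction.P₁ = (5,5,3)`: `γ₁ = 200, γ₂ = 2410, γ₃ = 4820,
  γ₄ = 1605, per = 4015`), and the coordinate gadgets `CG(a,k)`, `S`'s coordinates, `CG(b,k)` of
  `BKReduction` as coordinate words selected by word arithmetic are shared with the LCS twin
  (`BKLCSReduction.cgX_eq/cgS_eq/cgY_eq`, `toNat_getD_coordX/Y` of `LCSOVBits`, which speak about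
  the re-exported `BKReduction.cgX/cgS/cgY` and the words `1ₓ = 11100, 0ₓ = 10011, 1_y = 00111,
  0_y = 11001`).

[folklore] engineering over [cite: BringmannKunnemannFOCS2015, Lemma 5.3 and §3.1].
-/

namespace Literature.Computability.FineGrained

open Cryptography BKLCS
open scoped List

namespace BKGadget

namespace Params

variable (P : Params)

/-! ### Bits of a period and of the gadget strings -/

/-- Bit `r` of the period `G(z) 0^{γ₂} = 1^{γ₁} 0^{γ₁} 1^{γ₁} 0^{γ₁} z 0^{γ₁} 1^{γ₁} 0^{γ₁} 1^{γ₁} 0^{γ₂}`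
of a block `z` of length `ℓ` (BK15 Lemma 5.3, `ρ = 2`). [cite: BringmannKunnemannFOCS2015, Lemma 5.3] -/
def blockBit (ℓ : ℕ) (z : List Bool) (r : ℕ) : Bool :=
  if r < P.γ₁ then true
  else if r < 2 * P.γ₁ then false
  else if r < 3 * P.γ₁ then true
  else if r < 4 * P.γ₁ then false
  else if r < 4 * P.γ₁ + ℓ then z.getD (r - 4 * P.γ₁) false
  else if r < 5 * P.γ₁ + ℓ then false
  else if r < 6 * P.γ₁ + ℓ then true
  else if r < 7 * P.γ₁ + ℓ then false
  else if r < 8 * P.γ₁ + ℓ then true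
  else false

/-- The period `|G(z) 0^{γ₂}| = 8γ₁ + ℓ + γ₂` of blocks of length `ℓ`. [folklore] -/
def perOf (ℓ : ℕ) : ℕ := 8 * P.γ₁ + ℓ + P.γ₂

/-- The period is positive (indeed `γ₂ ≥ 0`, `8γ₁ ≥ 0`, and we only need `ℓ > 0` or `γ's > 0`;
here from `ℓ > 0`). [folklore] -/
theorem perOf_pos {ℓ : ℕ} (hℓ : 0 < ℓ) : 0 < P.perOf ℓ := by
  unfold perOf; omega

/-- **Bits of a period.** [folklore] -/
theorem getD_guard_append_zeros {ℓ : ℕ} {z : List Bool} (hz : z.length = ℓ) (r : ℕ) :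
    (P.guard z ++ zeros P.γ₂).getD r false = P.blockBit ℓ z r := by
  unfold blockBit
  simp only [guard, List.append_assoc]
  -- range 1: ones
  rw [getD_append_eq_ite, length_ones]
  by_cases h1 : r < P.γ₁
  · rw [if_pos h1, if_pos h1, ones, getD_replicate_bool, if_pos h1]
  rw [if_neg h1, if_neg h1, getD_append_eq_ite, length_zeros]
  -- range 2: zeros
  by_cases h2 : r < 2 * P.γ₁
  · rw [if_pos (show r - P.γ₁ < P.γ₁ by omega), if_pos h2, zeros, getD_replicate_bool]; split_ifs <;> rfl
  rw [if_neg (show ¬ r - P.γ₁ < P.γ₁ by omega), if_neg h2, getD_append_eq_ite, length_ones]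
  -- range 3: ones
  by_cases h3 : r < 3 * P.γ₁
  · rw [if_pos (show r - P.γ₁ - P.γ₁ < P.γ₁ by omega), if_pos h3, ones, getD_replicate_bool,
      if_pos (show r - P.γ₁ - P.γ₁ < P.γ₁ by omega)]
  rw [if_neg (show ¬ r - P.γ₁ - P.γ₁ < P.γ₁ by omega), if_neg h3, getD_append_eq_ite, length_zeros]
  -- range 4: zeros
  by_cases h4 : r < 4 * P.γ₁
  · rw [if_pos (show r - P.γ₁ - P.γ₁ - P.γ₁ < P.γ₁ by omega), if_pos h4, zeros, getD_replicate_bool]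
    split_ifs <;> rfl
  rw [if_neg (show ¬ r - P.γ₁ - P.γ₁ - P.γ₁ < P.γ₁ by omega), if_neg h4, getD_append_eq_ite, hz]
  -- range 5: the block
  by_cases h5 : r < 4 * P.γ₁ + ℓ
  · rw [if_pos (show r - P.γ₁ - P.γ₁ - P.γ₁ - P.γ₁ < ℓ by omega), if_pos h5]
    congr 1; omega
  rw [if_neg (show ¬ r - P.γ₁ - P.γ₁ - P.γ₁ - P.γ₁ < ℓ by omega), if_neg h5, getD_append_eq_ite, length_zeros]
  -- range 6: zeros
  by_cases h6 : r < 5 * P.γ₁ + ℓ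
  · rw [if_pos (show r - P.γ₁ - P.γ₁ - P.γ₁ - P.γ₁ - ℓ < P.γ₁ by omega), if_pos h6, zeros, getD_replicate_bool]
    split_ifs <;> rfl
  rw [if_neg (show ¬ r - P.γ₁ - P.γ₁ - P.γ₁ - P.γ₁ - ℓ < P.γ₁ by omega), if_neg h6, getD_append_eq_ite,
    length_ones]
  -- range 7: ones
  by_cases h7 : r < 6 * P.γ₁ + ℓ
  · rw [if_pos (show r - P.γ₁ - P.γ₁ - P.γ₁ - P.γ₁ - ℓ - P.γ₁ < P.γ₁ by omega), if_pos h7, ones,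
      getD_replicate_bool, if_pos (show r - P.γ₁ - P.γ₁ - P.γ₁ - P.γ₁ - ℓ - P.γ₁ < P.γ₁ by omega)]
  rw [if_neg (show ¬ r - P.γ₁ - P.γ₁ - P.γ₁ - P.γ₁ - ℓ - P.γ₁ < P.γ₁ by omega), if_neg h7, getD_append_eq_ite,
    length_zeros]
  -- range 8: zeros
  by_cases h8 : r < 7 * P.γ₁ + ℓ
  · rw [if_pos (show r - P.γ₁ - P.γ₁ - P.γ₁ - P.γ₁ - ℓ - P.γ₁ - P.γ₁ < P.γ₁ by omega), if_pos h8, zeros,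
      getD_replicate_bool]
    split_ifs <;> rfl
  rw [if_neg (show ¬ r - P.γ₁ - P.γ₁ - P.γ₁ - P.γ₁ - ℓ - P.γ₁ - P.γ₁ < P.γ₁ by omega), if_neg h8,
    getD_append_eq_ite, length_ones]
  -- range 9: ones
  by_cases h9 : r < 8 * P.γ₁ + ℓ
  · rw [if_pos (show r - P.γ₁ - P.γ₁ - P.γ₁ - P.γ₁ - ℓ - P.γ₁ - P.γ₁ - P.γ₁ < P.γ₁ by omega), if_pos h9, ones,
      getD_replicate_bool,
      if_pos (show r - P.γ₁ - P.γ₁ - P.γ₁ - P.γ₁ - ℓ - P.γ₁ - P.γ₁ - P.γ₁ < P.γ₁ by omega)]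
  rw [if_neg (show ¬ r - P.γ₁ - P.γ₁ - P.γ₁ - P.γ₁ - ℓ - P.γ₁ - P.γ₁ - P.γ₁ < P.γ₁ by omega), if_neg h9, zeros,
    getD_replicate_bool]
  -- range 10: the separator
  split_ifs <;> rfl

/-- Bits of a single guard are bits of its period. [folklore] -/
theorem getD_guard {ℓ : ℕ} {z : List Bool} (hz : z.length = ℓ) {r : ℕ} (hr : r < (P.guard z).length) :
    (P.guard z).getD r false = P.blockBit ℓ z r := by
  rw [← P.getD_guard_append_zeros hz r, getD_append_eq_ite, if_pos hr]

/-- **Bits of `G(z₀) 0^{γ₂} ⋯ 0^{γ₂} G(z_{k-1})`** for blocks of a common length `ℓ > 0`: bit `p` is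
bit `p % per` of the period of block `p / per`. [folklore] -/
theorem getD_gadgetX {ℓ : ℕ} (hℓ : 0 < ℓ) :
    ∀ (zs : List (List Bool)), (∀ z ∈ zs, z.length = ℓ) → ∀ p, p < (P.gadgetX zs).length →
      (P.gadgetX zs).getD p false = P.blockBit ℓ (zs.getD (p / P.perOf ℓ) []) (p % P.perOf ℓ)
  | [], _, p, hp => by simp at hp
  | [z], h, p, hp => by
      have hz : z.length = ℓ := h z (by simp)
      simp only [gadgetX_singleton] at hp ⊢
      have hlt : p < P.perOf ℓ := by
        rw [P.length_guard, hz] at hp; simp only [perOf]; omega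
      rw [Nat.div_eq_of_lt hlt, Nat.mod_eq_of_lt hlt]
      exact P.getD_guard hz hp
  | z :: z' :: zs, h, p, hp => by
      have hz : z.length = ℓ := h z (by simp)
      have h' : ∀ w ∈ z' :: zs, w.length = ℓ := fun w hw => h w (by simp [hw])
      have hper : (P.guard z ++ zeros P.γ₂).length = P.perOf ℓ := by
        simp [P.length_guard, hz, perOf]
      have hpos : 0 < P.perOf ℓ := P.perOf_pos hℓ
      rw [P.gadgetX_cons z (List.cons_ne_nil _ _)] at hp ⊢
      rw [getD_append_eq_ite, hper]
      split_ifs with hlt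
      · rw [Nat.div_eq_of_lt hlt, Nat.mod_eq_of_lt hlt, List.getD_cons_zero]
        exact P.getD_guard_append_zeros hz p
      · rw [not_lt] at hlt
        have hp' : p - P.perOf ℓ < (P.gadgetX (z' :: zs)).length := by
          rw [List.length_append, hper] at hp; omega
        rw [getD_gadgetX hℓ (z' :: zs) h' (p - P.perOf ℓ) hp']
        have e1 : p / P.perOf ℓ = (p - P.perOf ℓ) / P.perOf ℓ + 1 := by
          rw [Nat.div_eq_sub_div hpos hlt]
        rw [e1, List.getD_cons_succ, Nat.mod_eq_sub_mod hlt]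

/-- **Bits of `y = 0^{N} core 0^{N}`** (`N = n' γ₃`, `core = G(y₀) 0^{γ₂} ⋯ G(y_{m-1})`, which is
`gadgetX ys`). [folklore] -/
theorem getD_gadgetY (n' : ℕ) (ys : List (List Bool)) (p : ℕ) :
    (P.gadgetY n' ys).getD p false =
      if p < n' * P.γ₃ then false
      else if p - n' * P.γ₃ < (P.gadgetX ys).length then (P.gadgetX ys).getD (p - n' * P.γ₃) false
      else false := by
  have hY : P.gadgetY n' ys = zeros (n' * P.γ₃) ++ P.gadgetX ys ++ zeros (n' * P.γ₃) := rfl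
  rw [hY, getD_append_eq_ite, List.length_append, length_zeros, getD_append_eq_ite, length_zeros]
  by_cases h1 : p < n' * P.γ₃
  · rw [if_pos (by omega), if_pos h1, if_pos h1, zeros, getD_replicate_bool, if_pos h1]
  · rw [if_neg h1, if_neg h1]
    by_cases h2 : p - n' * P.γ₃ < (P.gadgetX ys).length
    · rw [if_pos (by omega), if_pos h2]
    · rw [if_neg (by omega), if_neg h2, zeros, getD_replicate_bool]
      split_ifs <;> rfl

end Params

end BKGadget

/-! ### The numerals of level 1 -/

namespace BKReduction

open BKGadget BKLCSReduction

/-- `γ₁ = 200` at level 1. [folklore] -/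
theorem P₁_γ₁ : P₁.γ₁ = 200 := rfl
/-- `γ₂ = 2410` at level 1. [folklore] -/
theorem P₁_γ₂ : P₁.γ₂ = 2410 := rfl
/-- `γ₃ = 4820` at level 1. [folklore] -/
theorem P₁_γ₃ : P₁.γ₃ = 4820 := rfl
/-- `γ₄ = 1605` at level 1. [folklore] -/
theorem P₁_γ₄ : P₁.γ₄ = 1605 := rfl
/-- `ℓₓ = 5` at level 1. [folklore] -/
theorem P₁_ℓx : P₁.ℓx = 5 := rfl
/-- `ℓ_y = 5` at level 1. [folklore] -/
theorem P₁_ℓy : P₁.ℓy = 5 := rfl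
/-- `sₓ = 3` at level 1. [folklore] -/
theorem P₁_sx : P₁.sx = 3 := rfl
/-- The period `4015` at level 1. [folklore] -/
theorem P₁_perOf : P₁.perOf 5 = 4015 := rfl

/-! ### The coordinate gadgets as selected coordinate words

These are `BKLCSReduction.cgX_eq`, `cgS_eq`, `cgY_eq` of `LCSOVBits` verbatim: the LCS twin
re-exports the coordinate gadgets `BKReduction.cgX/cgS/cgY`, so those lemmas already speak about the
edit-distance gadgets and are used as they are. -/

end BKReduction

end Literature.Computability.FineGrained
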